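import Summits.BirchSwinnertonDyer.BirchSwinnertonDyer.Theorems.PrintCf2SplitBadTwoKernelOnKummerLine
import Summits.BirchSwinnertonDyer.BirchSwinnertonDyer.Theorems.PrintCf2SplitBadTwoKummerComponentAtVbar
import Summits.BirchSwinnertonDyer.BirchSwinnertonDyer.Theorems.PrintCf2SplitBadTwoLocalKummerDivisibility
import Summits.BirchSwinnertonDyer.BirchSwinnertonDyer.Theorems.PrintCf2SplitBadTwoLocalPointsPadicTransport
import Summits.BirchSwinnertonDyer.BirchSwinnertonDyer.Theorems.PrintCf2SplitBadTwoKummerLineOfGenerator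
import Summits.BirchSwinnertonDyer.BirchSwinnertonDyer.Theorems.PrintCf2SplitBadTwoLocalDepthOfGenerator
import Summits.BirchSwinnertonDyer.BirchSwinnertonDyer.Theorems.PrintCf2SplitBadTwoLocalCyclicOfFrame
import HarnessLib

/-!
# Crux `PrintCf2.SplitBadTwoRankOneOfFacts` (stmt-BirchSwinnertonDyer-20368), road α v10.3 — S3c (R-BV):
# THE FACTOR VALUE (F1) IS A THEOREM: `v₂ #(Q_M ⊓ ker loc_{v̄}) = ℓ + e₁([d]₂)` with `e₁ = 2 − t([d]₂) = −[d ≡ 3 (mod 8)]`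

Cell `bsd-print-cf2`, width seat `bsd-line-cf2-p1-w6` g3 (prover-bsd-line-cf2-p1-w6-g3-0). `--supports stmt-BirchSwinnertonDyer-20368`
(helper, Theses-free). HONEST FRAMING: this discharges ONE displayed hypothesis (`hF1`) of LEAD g12's cut 13
`RestrictedSelmerPair.restrictedControl_two_of_ptFacts_factor_values` (p674799); it closes no item and no registered stub by itself; BSD is
not proved by any of this; no summit statement is proved by this seat. No definition, no named fact, no `sorry`.

THE STATEMENT. **`hF1_holds`** = the hypothesis `hF1` VERBATIM with the class function `e₁ i j := if i = 1 ∧ j = 3 then −1 else 0`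
(the 2-adic key `(d % 2, (d / (2 − d % 2)) % 8) = (1, 3)` ⟺ `d ≡ 3 (mod 8)`; `e₁ = 2 − t([d]₂)`, `t = v₂ #W(ℚ₂)_tors + …` as in -w4 g6's
dyadic table): for every S3c frame, `v₂ #(Q_M ⊓ ker loc_{v̄}) = ℓ − [d ≡ 3 (8)]`.

THE PROOF (assembly of this seat's pieces; each step a tree theorem):
* `Q_M = ⋃_N ℤ·g_N`, `g_N = e_* res_⊤ κ_N(P_K)` (p674334 `exists_comap_kummer_eq_zsmul_of_frame`; `g_N ∈ Q_M` by -w3 g9's stability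
  `resSubgroup_kummer_stable`); tower `2 g_{N+1} = g_N`, `2^N g_N = 0` (`kummerMapLevel_level`, `kummerMapLevel_nsmul_self`);
* `g_1 ≠ 0`: `ι_* e_* κ_1(P_K) = κ_1(w(P₁ − N₂ P_K))` (-w3 g9 `resH1Hom_subtype_proj_kummerMapLevel`, `w` odd), `res_⊤` injective, and
  `P₁ − N₂ P_K ∉ 2E(K) + tors` (p673604 `not_exists_piSub_eq_pow_smul_of_frame`, Mordell–Weil + CM lattice algebra);
* `loc_{v̄} g_N = 0 ⟺ loc_{v̄} res_⊤ κ_N(P_K) = 0` (piece (B) p675955, ⟸ (T-loc at `v̄`) which is -w3 g9's THEOREM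
  `LocalTrichotomy.classical_local_cyclic` at `(v̄, v)` + `kummer_local_cyclic_of_classical`, and (F1)'s own `Finite 𝔖_{v̄}(K, W*)`)
  ⟺ `P_K ∈ 2^N E(K_{v̄}) + tors` (piece (C) p676883) ⟺ `P₂ ∈ 2^N W(ℚ₂) + tors` (piece (D) p677548, `K_{v̄} ≅ ℚ₂`)
  ⟺ `N ≤ ℓ − [d ≡ 3 (8)]` (piece (L2) p675150, the `ℤ₂`-linear logarithm and -w4 g6's image `2^{[d≡3(8)]}ℤ₂`);
* hence `#(Q_M ⊓ ker loc_{v̄}) = 2^{ℓ − [d≡3(8)]}` (piece (A) p675685 `padicValNat_natCard_inf_ker_eq`).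
presearch: the assembled statement is this programme's (F1) (Agboola 2007 §6 Prop. 6.11 / Rubin LNM 1716 §3 bookkeeping for `r = 1`); no new
Literature fact. beyond-print theorem: no.

References: [Agboola2007] §6 Props. 6.10–6.11; [GreenbergLNM1716] §2; [Rubin1999] §2–§3; [SilvermanAEC2009] VIII §2, X §4.
-/

noncomputable section

open scoped Classical

set_option linter.dupNamespace false
set_option autoImplicit false

open NumberField IsDedekindDomain Field WeierstrassCurve
open Literature.NumberTheory.EllipticCurves Literature.NumberTheory.EllipticCurves.GreenbergSelmer
open Literature.NumberTheory.EllipticCurves.Castella2018.AcSelmer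
open Literature.NumberTheory.EllipticCurves.Agboola2007
open Literature.NumberTheory.EllipticCurves.ResKernel
open Literature.NumberTheory.GaloisRepresentations

namespace Summit.BirchSwinnertonDyer.BirchSwinnertonDyer.Theorems.PrintCf2.RestrictedSelmerPair

open Summit.BirchSwinnertonDyer.BirchSwinnertonDyer.Theorems.PrintCf2.CMPrimes
open Summit.BirchSwinnertonDyer.BirchSwinnertonDyer.Theorems.PrintCf2.DyadicTorsion
open Summit.BirchSwinnertonDyer.BirchSwinnertonDyer.Theorems.PrintCf2.LocalTrichotomy

/-- The 2-adic key of (F1): for `d ≢ 1 (mod 4)` squarefree (indeed for every integer), `(d % 2 = 1 ∧ (d / (2 − d % 2)) % 8 = 3) ⟺ d % 8 = 3`.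
[folklore] -/
theorem key_eq_one_three_iff (d : ℤ) : (d % 2 = 1 ∧ d / (2 - d % 2) % 8 = 3) ↔ d % 8 = 3 := by
  constructor
  · rintro ⟨h1, h3⟩
    rw [h1, show (2 : ℤ) - 1 = 1 by norm_num, Int.ediv_one] at h3
    exact h3
  · intro h3
    have h1 : d % 2 = 1 := by omega
    refine ⟨h1, ?_⟩
    rw [h1, show (2 : ℤ) - 1 = 1 by norm_num, Int.ediv_one]
    exact h3

/-- **(F1) HOLDS: `v₂ #(Q_M ⊓ ker loc_{v̄}) = ℓ − [d ≡ 3 (mod 8)]` on every S3c frame** — the hypothesis `hF1` of LEAD g12's cut 13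
`restrictedControl_two_of_ptFacts_factor_values` (p674799) VERBATIM, with `e₁ i j := if i = 1 ∧ j = 3 then −1 else 0` (`= 2 − t([d]₂)`).
Assembly of pieces (A) p675685, (B) p675955, (C) p676883, (D) p677548, (L2) p675150, the line structure p674334, `g_1 ≠ 0` from p673604,
and -w3 g9's (T-loc-cl) theorem at `v̄`. [cite: Agboola2007, §6 Props. 6.10–6.11 (arXiv p0014)] [cite: GreenbergLNM1716, §2 Prop. 2.1]
[cite: SilvermanAEC2009, VIII §2 and X §4] -/
theorem hF1_holds : ∃ e₁ : ℤ → ℤ → ℤ, ∀ (d : ℤ), d ≠ 0 → Squarefree d → d % 4 ≠ 1 →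
      ∀ (W : WeierstrassCurve ℚ) [W.IsElliptic] [W.IsGloballyMinimal] (C : WeierstrassCurve.VariableChange ℚ),
        C • W = cm7.quadraticTwist (d : ℚ) → W.analyticRank = 1 →
      ∀ (K : Type) [Field K] [NumberField K], IsImaginaryQuadratic K →
      ∀ (v vbar : HeightOneSpectrum (𝓞 K)),
        ((2 : ℕ) : 𝓞 K) ∈ v.asIdeal → ((2 : ℕ) : 𝓞 K) ∈ vbar.asIdeal → vbar ≠ v →
      ∀ (π : (W.baseChange K).endRing), (π : AddMonoid.End (W.baseChange K).geomPoints) * π = π - 2 →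
      ∀ (r : ℤ_[2]), r * r = r - 2 →
        (∀ τ ∈ GreenbergSelmer.inertia v, ∀ x : ↥((W.baseChange K).endEigenPrimaryTorsion 2 π r), τ • x = x ∨ τ • x = -x) →
      ∀ (P : W.toAffine.Point) (c₀ : ℕ) (ℓ : ℤ),
        ¬ IsOfFinAddOrder P →
        (∀ R : W.toAffine.Point, ∃ (k : ℤ) (T : W.toAffine.Point), IsOfFinAddOrder T ∧ R = k • P + T) →
        c₀ ≠ 0 → (W.baseChange ℚ_[2]).IsInReductionKernel (c₀ • W.toPadicPoint 2 P) →
        ‖(W.baseChange ℚ_[2]).padicLogPoint (c₀ • W.toPadicPoint 2 P) / (c₀ : ℚ_[2])‖ = (2 : ℝ) ^ (-ℓ) →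
      Finite (restrictedSelmerBase ↥((W.baseChange K).endEigenPrimaryTorsion 2 π r) 2 vbar) →
        (padicValNat 2 (Nat.card ↥(((((W.baseChange K).kummerMapPInfty 2 (W.baseChange K).zsmul_geomPoints_surjective_holds).range).map
            (resSubgroup ⊤ ((W.baseChange K).geomPrimaryTorsion 2))).comap
          (resH1Hom (ContinuousMonoidHom.id _) ((W.baseChange K).endEigenPrimaryTorsion 2 π r).subtype (fun _ _ ↦ rfl)) ⊓
          (resOfLe ↥((W.baseChange K).endEigenPrimaryTorsion 2 π r) (inf_le_left : ⊤ ⊓ decomp vbar ≤ ⊤)).ker)) : ℤ) = ℓ + e₁ (d % 2) ((d / (2 - d % 2)) % 8) := by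
  refine ⟨fun i j ↦ if i = 1 ∧ j = 3 then -1 else 0, ?_⟩
  intro d hd0 hsq hd4 W _ _ C hC _ K _ _ hK v vbar hv hvbar hne π hrel r hr _ P c₀ ℓ hP hgen hc₀ hker hℓ hfin
  haveI : Fact (Nat.Prime 2) := ⟨Nat.prime_two⟩
  -- the frame's projectors
  obtain ⟨hinf, hsup⟩ := endEigenPrimaryTorsion_compl_of_frame hd0 W C hC K π hrel hr
  have hunit : IsUnit (r - (1 - r)) := (two_dvd_or_two_dvd_one_sub_of_root hr).2
  obtain ⟨e, he₁, -, he₃, he⟩ := exists_eigenProjector (W.baseChange K) 2 π r (1 - r) hinf hsup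
  obtain ⟨e', he'₁, he'₂, -, he'⟩ := exists_eigenProjector (W.baseChange K) 2 π (1 - r) r (by rw [inf_comm]; exact hinf)
    (by rw [sup_comm]; exact hsup)
  have hsum := coe_proj_add_coe_proj (W.baseChange K) 2 π r (1 - r) e e' he₃ he'₁ he'₂
  -- notation: the `K`-point, the two coefficient maps, the tower
  set PK : (W.baseChange K).toAffine.Point := Affine.Point.map (W' := W.toAffine) (Algebra.ofId ℚ K) P
  set eStar : subgroupH1 (⊤ : Subgroup (absoluteGaloisGroup K)) ((W.baseChange K).geomPrimaryTorsion 2) →+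
      subgroupH1 (⊤ : Subgroup (absoluteGaloisGroup K)) ↥((W.baseChange K).endEigenPrimaryTorsion 2 π r) :=
    resH1Hom (ContinuousMonoidHom.id (⊤ : Subgroup (absoluteGaloisGroup K))) e (fun σ x ↦ he σ x)
  set κN : ℕ → subgroupH1 (⊤ : Subgroup (absoluteGaloisGroup K)) ((W.baseChange K).geomPrimaryTorsion 2) := fun N ↦
    resSubgroup ⊤ ((W.baseChange K).geomPrimaryTorsion 2)
      ((W.baseChange K).kummerMapLevel 2 (W.baseChange K).zsmul_geomPoints_surjective_holds N PK) with hκN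
  set g : ℕ → subgroupH1 (⊤ : Subgroup (absoluteGaloisGroup K)) ↥((W.baseChange K).endEigenPrimaryTorsion 2 π r) :=
    fun N ↦ eStar (κN N) with hg
  set Q₀ := (((W.baseChange K).kummerMapPInfty 2 (W.baseChange K).zsmul_geomPoints_surjective_holds).range).map
    (resSubgroup ⊤ ((W.baseChange K).geomPrimaryTorsion 2))
  -- membership of the tower in `Q₀`
  have hκN_mem : ∀ N, κN N ∈ Q₀ := fun N ↦
    ⟨_, ⟨PK ⊗ₜ prufGen 2 N, rfl⟩, by rw [(W.baseChange K).kummerMapPInfty_tmul_prufGen]⟩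
  -- the tower relations
  have hg_succ : ∀ N, 2 • g (N + 1) = g N := fun N ↦ by
    have hlev := (W.baseChange K).kummerMapLevel_level 2 (W.baseChange K).zsmul_geomPoints_surjective_holds N 1 (N + 1) rfl PK
    rw [pow_one] at hlev
    simp only [hg, hκN, ← map_nsmul, hlev]
  have hg_zero : ∀ N, 2 ^ N • g N = 0 := fun N ↦ by
    simp only [hg, hκN, ← map_nsmul]
    rw [(W.baseChange K).kummerMapLevel_nsmul_self 2 _ N PK, map_zero, map_zero]
  -- `g 1 ≠ 0`
  have hg_one : g 1 ≠ 0 := by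
    intro h0
    obtain ⟨N₁, N₂, w, hN₁, hN₂, hw⟩ := exists_proj_levelData (p := 2) (r := r) (r' := 1 - r) hunit 1
    obtain ⟨P₁, hP₁⟩ := exists_toGeomPoints_eq_endRing_apply (W.baseChange K) π PK
    -- `res_⊤ κ_1(w • (P₁ − N₂ • P_K)) = ι_* (g 1) = 0`
    have hce := congrArg (fun f ↦ f ((W.baseChange K).kummerMapLevel 2 (W.baseChange K).zsmul_geomPoints_surjective_holds 1 PK))
      (resH1Hom_comp_resSubgroup (ContinuousMonoidHom.id (absoluteGaloisGroup K)) e (fun σ x ↦ he σ x) ⊤ ⊤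
        (ContinuousMonoidHom.id (⊤ : Subgroup (absoluteGaloisGroup K))) (fun _ ↦ rfl) (fun σ x ↦ he σ x))
    have hcι := congrArg (fun f ↦ f (resH1Hom (ContinuousMonoidHom.id (absoluteGaloisGroup K)) e (fun σ x ↦ he σ x)
        ((W.baseChange K).kummerMapLevel 2 (W.baseChange K).zsmul_geomPoints_surjective_holds 1 PK)))
      (resH1Hom_comp_resSubgroup (ContinuousMonoidHom.id (absoluteGaloisGroup K)) ((W.baseChange K).endEigenPrimaryTorsion 2 π r).subtype
        (fun _ _ ↦ rfl) ⊤ ⊤ (ContinuousMonoidHom.id (⊤ : Subgroup (absoluteGaloisGroup K))) (fun _ ↦ rfl) (fun _ _ ↦ rfl))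
    simp only [AddMonoidHom.comp_apply] at hce hcι
    have hκ' : resSubgroup ⊤ ((W.baseChange K).geomPrimaryTorsion 2)
        ((W.baseChange K).kummerMapLevel 2 (W.baseChange K).zsmul_geomPoints_surjective_holds 1 (w • (P₁ - N₂ • PK))) = 0 := by
      rw [← resH1Hom_subtype_proj_kummerMapLevel (W.baseChange K) 2 π r (1 - r) e e' he hsum hN₁ hN₂ hw PK P₁ hP₁, ← hcι, ← hce]
      change resH1Hom (ContinuousMonoidHom.id (⊤ : Subgroup (absoluteGaloisGroup K)))
          ((W.baseChange K).endEigenPrimaryTorsion 2 π r).subtype (fun _ _ ↦ rfl) (g 1) = 0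
      rw [h0, map_zero]
    have hκ0 : (W.baseChange K).kummerMapLevel 2 (W.baseChange K).zsmul_geomPoints_surjective_holds 1 (w • (P₁ - N₂ • PK)) = 0 :=
      resSubgroup_injective_of_forall_mem ⊤ _ (fun σ ↦ Subgroup.mem_top σ) (by rw [hκ', map_zero])
    -- so `w • (P₁ − N₂ • P_K) ∈ 2 E(K) + tors`, `w` odd — contradicting p673604
    obtain ⟨m, P₀, hm⟩ := (W.baseChange K).exists_of_kummerMapLevel_eq_zero 2 _ 1 _ hκ0
    obtain ⟨u, hu⟩ := odd_of_levelData one_ne_zero hw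
    refine MordellWeilCM.not_exists_piSub_eq_pow_smul_of_frame W K hK π hrel hP hgen hP₁ N₂ (N := 1) le_rfl
      ⟨P₀ - u • (P₁ - N₂ • PK), w • (P₁ - N₂ • PK) - 2 • P₀, ?_, ?_⟩
    · refine isOfFinAddOrder_iff_nsmul_eq_zero.mpr ⟨2 ^ m, pow_pos two_pos m, ?_⟩
      rw [smul_sub, hm, pow_add, pow_one, mul_smul, smul_comm (2 ^ m) 2 P₀, sub_self]
    · rw [hu]
      module
  -- `Q_M` is exhausted by and contains the tower
  have hQ : ∀ q ∈ Q₀.comap (resH1Hom (ContinuousMonoidHom.id _) ((W.baseChange K).endEigenPrimaryTorsion 2 π r).subtype (fun _ _ ↦ rfl)),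
      ∃ (N : ℕ) (k : ℤ), q = k • g N := fun q hq ↦
    exists_comap_kummer_eq_zsmul_of_frame W K hK π hrel hunit e e' he₁ he hsum hP hgen hq
  have hgQ : ∀ N, g N ∈ Q₀.comap (resH1Hom (ContinuousMonoidHom.id _) ((W.baseChange K).endEigenPrimaryTorsion 2 π r).subtype
      (fun _ _ ↦ rfl)) := fun N ↦ by
    rw [AddSubgroup.mem_comap]
    exact resSubgroup_kummer_stable (W.baseChange K) 2 π r (1 - r) hunit e e' he hsum _ (hκN_mem N)
  -- the local criterion at `v̄`: `loc_{v̄} g_N = 0 ⟺ N ≤ D`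
  have hcyc := kummer_local_cyclic_of_classical (W.baseChange K) 2 vbar (classical_local_cyclic hK hvbar hv hne.symm (W.baseChange K))
  have hD : ∀ N, resOfLe ↥((W.baseChange K).endEigenPrimaryTorsion 2 π r) (inf_le_left : ⊤ ⊓ decomp vbar ≤ ⊤) (g N) = 0 ↔
      N ≤ ℓ.toNat - (if d % 8 = 3 then 1 else 0) := fun N ↦ by
    have h1 := (resOfLe_kummer_eq_zero_iff_proj_of_frame hd0 W C hC hK vbar π hrel hr P hP e e' he he' hsum hcyc hfin (hκN_mem N)).symm
    have h2 := resOfLe_resSubgroup_kummerMapLevel_eq_zero_iff (W.baseChange K) 2 vbar PK N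
    have h3 := exists_localPoints_iff_exists_padicPoint_of_frame hK.1 hv hvbar hne W P (2 ^ N)
    have h4 := exists_pow_smul_add_torsion_iff_of_frame' hd0 hsq hd4 W hC hc₀ hker hℓ N
    exact h1.trans (h2.trans (h3.trans h4))
  -- count
  have hcount := padicValNat_natCard_inf_ker_eq g hg_succ hg_zero hg_one _ hQ hgQ
    (resOfLe ↥((W.baseChange K).endEigenPrimaryTorsion 2 π r) (inf_le_left : ⊤ ⊓ decomp vbar ≤ ⊤)) hD
  refine ((congrArg (fun n : ℕ ↦ (n : ℤ)) hcount).trans ?_)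
  -- arithmetic: `↑(ℓ.toNat − [d ≡ 3 (8)]) = ℓ + e₁(key)`
  beta_reduce
  have hel : (if d % 8 = 3 then (1 : ℤ) else 0) ≤ ℓ := le_ell_of_smul_eq_quadraticTwist d hd0 hsq hd4 W C hC P c₀ ℓ hc₀ hker hℓ
  have hkey := key_eq_one_three_iff d
  by_cases h3 : d % 8 = 3
  · rw [if_pos h3, if_pos (hkey.mpr h3)]
    rw [if_pos h3] at hel
    omega
  · rw [if_neg h3, if_neg (fun h ↦ h3 (hkey.mp h))]
    rw [if_neg h3] at hel
    omega

end Summit.BirchSwinnertonDyer.BirchSwinnertonDyer.Theorems.PrintCf2.RestrictedSelmerPair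

end
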